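import Summits.CriticalPhenomena.PercolationContinuityZ3.Theorems.PercNearOneGluingNoHeavyQuantFarTreeHubBlocks
import Summits.CriticalPhenomena.PercolationContinuityZ3.Theorems.PercNearOneGluingNoHeavyQuantRatioRegularVertexForm
import HarnessLib

/-!
# QUANT lane R8, FAR on trees: "hub with leaves + ANY root blocks" reduced to the hub-world PROFILE functional,
# and — through the ratio-regular certificate — to the vertex inequalities `(V_{t,b₁})`

builds on p205010 (kernel theorem, internal audit signed; external expert review pending)

Support file (`--supports stmt-CriticalPhenomena-4575`), QUANT lane typer seat prim-quant-stmt (gen 12); memo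
`run/shared/lean/prim/quant/prim-quant-stmt-g12/MTL-PROFILE-LP.md`.  Theorems only; no definitions, no sorries, standard axioms.

Setting of `Quant.farTree_hubBlocks` (…QuantFarTreeHubBlocks.lean, gen 11): gates `q` on `Fin n`; observer `o`; hub `h` with leaf relays `L`;
root block vertices `b ∈ K` with glued tails `B b`; block sizes `s b = |B b| + 1`; hub-world counts `X = #(L ∩ ω)`, `W = Σ_{b ∈ K ∩ ω} s b`,
`R = W + 1[h ∈ ω]·X`.  No regime, no common gate, no credit cap: the blocks are arbitrary.

* `Quant.determinedBy_filter_fun` — an event read off `K.filter (· ∈ ω)` is determined by `K`.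
* `Quant.hubWorld_sum_reach_eq` — `P(W + X ≥ i) = Σ_{b ≤ |L|} P(X = b)·P(W ≥ i − b)` (independence of `L` and `K`).
* `Quant.hubWorld_reach_eq` — **the profile identity**: `P(R ≥ j+1) = (1 − q h)·P(W ≥ j+1) + q h·Σ_{b ≤ |L|} P(X = b)·P(W ≥ j+1−b)`.
* `Quant.farTree_hubBlocks_of_profile` — **FAR-deficit = profile functional**: for every `τ` with
  `τ ≤ Σ_{b ≤ |L|} P(X = b)·(P(W ≥ j+1−b) + ((1 − q h)/q h)·P(W ≥ j+1))` one has `P(#{a ∈ A counted} ≤ j) ≤ 1 − q h·τ`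
  (`Quant.farTree_hubBlocks_countReduce` + the identity).  With `τ = min(U_L/|L|, g_min/q h)` the right side is `≤ 1 − θ`, `θ` the least marginal.
* `Quant.farTree_hubBlocks_of_vertices` — **FAR at every layer for hub + leaves + any root blocks, CONDITIONAL on the vertex inequalities**
  `(V_{t,b₁})` of the memo for the block profile `ℓ b = P(W ≥ j+1−b) + ρ·P(W ≥ j+1)` (`Quant.pb_expectation_ge_of_vertices`: the leaf count is
  ratio-regular by `Quant.pb_ratio`).  The `(V_{t,b₁})` are elementary inequalities in the block parameters (exact census 306 000 / 0, memo §6–§7);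
  proving them closes LEAD-NOTES-G6 N14 (4) in full.
[cite: KozmaNitzan2024, Conjecture 3 (p. 15)] (the gluing rows served); the reduction is [this work].
-/

noncomputable section

namespace Summit.CriticalPhenomena.PercolationContinuityZ3.Theorems

namespace Quant

open Finset MeasureTheory
open Literature.Probability.LatticeModels
open Literature.Probability.Percolation
open scoped Classical

variable {n : ℕ}

/-- An event read off `K.filter (· ∈ ω)` is determined by the coordinates in `K`. [folklore] -/
theorem determinedBy_filter_fun (K : Finset (Fin n)) (F : Finset (Fin n) → Prop) :
    DeterminedBy {ω : Set (Fin n) | F (K.filter fun x => x ∈ ω)} (↑K : Set (Fin n)) := by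
  rw [determinedBy_iff]
  intro ω ω' hω
  have : (K.filter fun x => x ∈ ω) = (K.filter fun x => x ∈ ω') := by
    refine Finset.filter_congr fun x hx => ?_
    constructor
    · intro h; have : x ∈ ω ∩ ↑K := ⟨h, hx⟩; rw [hω] at this; exact this.1
    · intro h; have : x ∈ ω' ∩ ↑K := ⟨h, hx⟩; rw [← hω] at this; exact this.1
  simp only [Set.mem_setOf_eq, this]

/-- **Independence of the leaf count and the block sum**: for disjoint `L`, `K` and every threshold `i`,
`P(W + X ≥ i) = Σ_{b ≤ |L|} P(X = b)·P(W ≥ i − b)` (`X = #(L ∩ ω)`, `W = Σ_{x ∈ K ∩ ω} s x`; truncated subtraction). [folklore] -/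
theorem hubWorld_sum_reach_eq (q : Fin n → unitInterval) (L K : Finset (Fin n)) (s : Fin n → ℕ) (hLK : Disjoint L K) (i : ℕ) :
    (prodBernoulli q).real {ω : Set (Fin n) | i ≤ (∑ x ∈ K.filter (fun x => x ∈ ω), s x) + (L.filter fun x => x ∈ ω).card} =
      ∑ b ∈ Finset.range (L.card + 1),
        (prodBernoulli q).real {ω : Set (Fin n) | (L.filter fun x => x ∈ ω).card = b} *
          (prodBernoulli q).real {ω : Set (Fin n) | i - b ≤ ∑ x ∈ K.filter (fun x => x ∈ ω), s x} := by
  set μ := prodBernoulli q with hμ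
  have hmeas : ∀ S : Set (Set (Fin n)), MeasurableSet S := fun S => MeasurableSet.of_discrete
  set Xb : ℕ → Set (Set (Fin n)) := fun b => {ω : Set (Fin n) | (L.filter fun x => x ∈ ω).card = b} with hXb
  set Wb : ℕ → Set (Set (Fin n)) := fun b => {ω : Set (Fin n) | i - b ≤ ∑ x ∈ K.filter (fun x => x ∈ ω), s x} with hWb
  have hev : {ω : Set (Fin n) | i ≤ (∑ x ∈ K.filter (fun x => x ∈ ω), s x) + (L.filter fun x => x ∈ ω).card} =
      ⋃ b ∈ Finset.range (L.card + 1), (Xb b ∩ Wb b) := by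
    ext ω
    simp only [Set.mem_setOf_eq, Set.mem_iUnion, Set.mem_inter_iff, Finset.mem_range, exists_prop, hXb, hWb]
    constructor
    · intro h
      refine ⟨(L.filter fun x => x ∈ ω).card, ?_, rfl, by omega⟩
      have := Finset.card_filter_le L (fun x => x ∈ ω)
      omega
    · rintro ⟨b, -, hb, hw⟩
      rw [hb]; omega
  have hdisj : (↑(Finset.range (L.card + 1)) : Set ℕ).PairwiseDisjoint fun b => Xb b ∩ Wb b := by
    intro b _ b' _ hbb'
    rw [Function.onFun, Set.disjoint_left]
    intro ω h1 h2
    have e1 : (L.filter fun x => x ∈ ω).card = b := h1.1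
    have e2 : (L.filter fun x => x ∈ ω).card = b' := h2.1
    exact hbb' (e1.symm.trans e2)
  rw [hev, measureReal_biUnion_finset hdisj (fun b _ => hmeas _) (fun b _ => measure_ne_top _ _)]
  refine Finset.sum_congr rfl fun b _ => ?_
  exact prodBernoulli_real_inter_of_determinedBy_disjoint q hLK
    (determinedBy_filter_fun L fun F => F.card = b) (determinedBy_filter_fun K fun F => i - b ≤ ∑ x ∈ F, s x) (hmeas _) (hmeas _)

/-- **The profile identity for the loose hub with root blocks.**  With `h ∉ L ∪ K`, `L ∩ K = ∅`, `X = #(L ∩ ω)`, `W = Σ_{x∈K∩ω} s x`,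
`R = W + 1[h∈ω]·X`:  `P(R ≥ j+1) = (1 − q h)·P(W ≥ j+1) + q h·Σ_{b ≤ |L|} P(X = b)·P(W ≥ j+1−b)`. [this work] -/
theorem hubWorld_reach_eq (q : Fin n → unitInterval) (h : Fin n) (L K : Finset (Fin n)) (s : Fin n → ℕ)
    (hhL : h ∉ L) (hhK : h ∉ K) (hLK : Disjoint L K) (j : ℕ) :
    (prodBernoulli q).real {ω : Set (Fin n) |
        j + 1 ≤ (∑ x ∈ K.filter (fun x => x ∈ ω), s x) + (if h ∈ ω then (L.filter fun x => x ∈ ω).card else 0)} =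
      (1 - (q h : ℝ)) * (prodBernoulli q).real {ω : Set (Fin n) | j + 1 ≤ ∑ x ∈ K.filter (fun x => x ∈ ω), s x} +
        (q h : ℝ) * ∑ b ∈ Finset.range (L.card + 1),
          (prodBernoulli q).real {ω : Set (Fin n) | (L.filter fun x => x ∈ ω).card = b} *
            (prodBernoulli q).real {ω : Set (Fin n) | j + 1 - b ≤ ∑ x ∈ K.filter (fun x => x ∈ ω), s x} := by
  set μ := prodBernoulli q with hμ
  have hmeas : ∀ S : Set (Set (Fin n)), MeasurableSet S := fun S => MeasurableSet.of_discrete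
  set E := {ω : Set (Fin n) |
    j + 1 ≤ (∑ x ∈ K.filter (fun x => x ∈ ω), s x) + (if h ∈ ω then (L.filter fun x => x ∈ ω).card else 0)} with hE
  set EW := {ω : Set (Fin n) | j + 1 ≤ ∑ x ∈ K.filter (fun x => x ∈ ω), s x} with hEW
  set EWX := {ω : Set (Fin n) | j + 1 ≤ (∑ x ∈ K.filter (fun x => x ∈ ω), s x) + (L.filter fun x => x ∈ ω).card} with hEWX
  set H1 := {ω : Set (Fin n) | h ∈ ω} with hH1
  set H0 := {ω : Set (Fin n) | h ∉ ω} with hH0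
  -- split on the hub gate
  have hsplit : E = (H0 ∩ EW) ∪ (H1 ∩ EWX) := by
    ext ω
    simp only [hE, hEW, hEWX, hH1, hH0, Set.mem_setOf_eq, Set.mem_union, Set.mem_inter_iff]
    by_cases hh : h ∈ ω
    · simp only [hh, if_true, not_true_eq_false, false_and, true_and, false_or]
    · simp only [hh, if_false, add_zero, not_false_eq_true, true_and, false_and, or_false]
  have hdisj : Disjoint (H0 ∩ EW) (H1 ∩ EWX) := by
    rw [Set.disjoint_left]
    intro ω h0 h1
    exact h0.1 h1.1
  -- independence of the hub gate from the rest
  have hKh : Disjoint ({h} : Finset (Fin n)) K := by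
    rw [Finset.disjoint_singleton_left]; exact hhK
  have hLKh : Disjoint ({h} : Finset (Fin n)) (K ∪ L) := by
    rw [Finset.disjoint_singleton_left, Finset.mem_union, not_or]; exact ⟨hhK, hhL⟩
  have dH1 : DeterminedBy H1 (↑({h} : Finset (Fin n)) : Set (Fin n)) := by
    rw [determinedBy_iff]; intro ω ω' hω
    have : h ∈ ω ∩ ↑({h} : Finset (Fin n)) ↔ h ∈ ω' ∩ ↑({h} : Finset (Fin n)) := by rw [hω]
    simp only [Set.mem_inter_iff, Finset.coe_singleton, Set.mem_singleton_iff, and_true] at this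
    exact this
  have dH0 : DeterminedBy H0 (↑({h} : Finset (Fin n)) : Set (Fin n)) := by
    rw [determinedBy_iff]; intro ω ω' hω
    have : h ∈ ω ∩ ↑({h} : Finset (Fin n)) ↔ h ∈ ω' ∩ ↑({h} : Finset (Fin n)) := by rw [hω]
    simp only [Set.mem_inter_iff, Finset.coe_singleton, Set.mem_singleton_iff, and_true] at this
    simp only [hH0, Set.mem_setOf_eq, this]
  have dEW : DeterminedBy EW (↑K : Set (Fin n)) := determinedBy_filter_fun K fun F => j + 1 ≤ ∑ x ∈ F, s x
  have dEWX : DeterminedBy EWX (↑(K ∪ L) : Set (Fin n)) := by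
    rw [determinedBy_iff]; intro ω ω' hω
    have hK' : (K.filter fun x => x ∈ ω) = (K.filter fun x => x ∈ ω') := by
      refine Finset.filter_congr fun x hx => ?_
      have hxU : x ∈ (↑(K ∪ L) : Set (Fin n)) := by simp [hx]
      constructor
      · intro h'; have : x ∈ ω ∩ ↑(K ∪ L) := ⟨h', hxU⟩; rw [hω] at this; exact this.1
      · intro h'; have : x ∈ ω' ∩ ↑(K ∪ L) := ⟨h', hxU⟩; rw [← hω] at this; exact this.1
    have hL' : (L.filter fun x => x ∈ ω) = (L.filter fun x => x ∈ ω') := by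
      refine Finset.filter_congr fun x hx => ?_
      have hxU : x ∈ (↑(K ∪ L) : Set (Fin n)) := by simp [hx]
      constructor
      · intro h'; have : x ∈ ω ∩ ↑(K ∪ L) := ⟨h', hxU⟩; rw [hω] at this; exact this.1
      · intro h'; have : x ∈ ω' ∩ ↑(K ∪ L) := ⟨h', hxU⟩; rw [← hω] at this; exact this.1
    simp only [hEWX, Set.mem_setOf_eq, hK', hL']
  have p0 : μ.real (H0 ∩ EW) = (1 - (q h : ℝ)) * μ.real EW := by
    rw [prodBernoulli_real_inter_of_determinedBy_disjoint q hKh dH0 dEW (hmeas _) (hmeas _), prodBernoulli_real_setOf_notMem]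
  have p1 : μ.real (H1 ∩ EWX) = (q h : ℝ) * μ.real EWX := by
    rw [prodBernoulli_real_inter_of_determinedBy_disjoint q hLKh dH1 dEWX (hmeas _) (hmeas _), prodBernoulli_real_setOf_mem]
  rw [hsplit, measureReal_union hdisj (hmeas _) (measure_ne_top _ _) (measure_ne_top _ _), p0, p1,
    hubWorld_sum_reach_eq q L K s hLK (j + 1)]

/-- **FAR-deficit of 'hub + leaves + root blocks' is the profile functional.**  Setting of `Quant.farTree_hubBlocks` (observer `o`, hub `h`
with leaf relays `L`, block vertices `K` with glued tails `B b`, relays `A = L ∪ ⋃_{b∈K}({b} ∪ B b)`; `s b = |B b| + 1`, `X = #(L ∩ ω)`,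
`W = Σ_{b∈K∩ω} s b`), hub gate `q h > 0`.  For every `τ` with
`τ ≤ Σ_{b ≤ |L|} P(X = b)·( P(W ≥ j+1−b) + ((1 − q h)/q h)·P(W ≥ j+1) )` one has `P(#{a ∈ A counted} ≤ j) ≤ 1 − q h·τ`. [this work] -/
theorem farTree_hubBlocks_of_profile (q : Fin n → unitInterval) (o h : Fin n) (L K : Finset (Fin n)) (B : Fin n → Finset (Fin n))
    (depth : Fin n → ℕ) (par : Fin n → Fin n) (j : ℕ) (τ : ℝ)
    (hK : ∀ b ∈ K, par b = o ∧ depth b = 0)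
    (hL : ∀ a ∈ L, par a = h ∧ depth a = 1) (hB : ∀ b ∈ K, ∀ a ∈ B b, par a = b ∧ depth a = 1)
    (hhL : h ∉ L) (hhK : h ∉ K) (hLK : Disjoint L K) (hLB : ∀ b ∈ K, Disjoint L (B b))
    (hKB : ∀ b ∈ K, ∀ b' ∈ K, b ∉ B b') (hBB : ∀ b ∈ K, ∀ b' ∈ K, b ≠ b' → Disjoint (B b) (B b'))
    (hqB : ∀ b ∈ K, ∀ a ∈ B b, q a = 1) (hqh : 0 < (q h : ℝ))
    (hτ : τ ≤ ∑ b ∈ Finset.range (L.card + 1),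
      (prodBernoulli q).real {ω : Set (Fin n) | (L.filter fun x => x ∈ ω).card = b} *
        ((prodBernoulli q).real {ω : Set (Fin n) | j + 1 - b ≤ ∑ x ∈ K.filter (fun x => x ∈ ω), ((B x).card + 1)} +
          (1 - (q h : ℝ)) / (q h : ℝ) *
            (prodBernoulli q).real {ω : Set (Fin n) | j + 1 ≤ ∑ x ∈ K.filter (fun x => x ∈ ω), ((B x).card + 1)})) :
    (prodBernoulli q).real {ω' : Set (Fin n) |
      ((L ∪ K.biUnion fun b => insert b (B b)).filter
        fun a => a = o ∨ ∀ i, i ≤ depth a → par^[i] a ∈ ω').card ≤ j} ≤ 1 - (q h : ℝ) * τ := by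
  set μ := prodBernoulli q with hμ
  have hmeas : ∀ S : Set (Set (Fin n)), MeasurableSet S := fun S => MeasurableSet.of_discrete
  set s : Fin n → ℕ := fun b => (B b).card + 1 with hs
  set P : ℕ → ℝ := fun b => μ.real {ω : Set (Fin n) | (L.filter fun x => x ∈ ω).card = b} with hP
  set TW : ℕ → ℝ := fun i => μ.real {ω : Set (Fin n) | i ≤ ∑ x ∈ K.filter (fun x => x ∈ ω), s x} with hTW
  -- Step 1: the tree count is at least the hub-world count `R`
  have hred := farTree_hubBlocks_countReduce q o h L K B depth par j hK hL hB hLK hLB hKB hBB hqB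
  -- Step 2: complement and the profile identity
  set ER := {ω : Set (Fin n) |
    (∑ x ∈ K.filter (fun x => x ∈ ω), ((B x).card + 1)) + (if h ∈ ω then (L.filter fun x => x ∈ ω).card else 0) ≤ j} with hER
  set ERc := {ω : Set (Fin n) |
    j + 1 ≤ (∑ x ∈ K.filter (fun x => x ∈ ω), s x) + (if h ∈ ω then (L.filter fun x => x ∈ ω).card else 0)} with hERc
  have hcompl : μ.real ER = 1 - μ.real ERc := by
    have hc : ERc = ERᶜ := by
      ext ω; simp only [hER, hERc, hs, Set.mem_setOf_eq, Set.mem_compl_iff]; omega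
    rw [hc, measureReal_compl (hmeas _), probReal_univ]
    ring
  have hid := hubWorld_reach_eq q h L K s hhL hhK hLK j
  have hone : ∑ b ∈ Finset.range (L.card + 1), P b = 1 := pb_levels_sum_one q L
  -- Step 3: `P(R ≥ j+1) = q h · Σ_b P(X=b) ℓ_b ≥ q h · τ`
  have hreach : (q h : ℝ) * τ ≤ μ.real ERc := by
    have hne : (q h : ℝ) ≠ 0 := hqh.ne'
    have e : μ.real ERc = (q h : ℝ) * ∑ b ∈ Finset.range (L.card + 1), P b * (TW (j + 1 - b) + (1 - (q h : ℝ)) / (q h : ℝ) * TW (j + 1)) := by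
      rw [hERc, hid]
      have e2 : ∑ b ∈ Finset.range (L.card + 1), P b * (TW (j + 1 - b) + (1 - (q h : ℝ)) / (q h : ℝ) * TW (j + 1)) =
          ∑ b ∈ Finset.range (L.card + 1), P b * TW (j + 1 - b) +
            (1 - (q h : ℝ)) / (q h : ℝ) * TW (j + 1) * ∑ b ∈ Finset.range (L.card + 1), P b := by
        rw [Finset.mul_sum, ← Finset.sum_add_distrib]
        exact Finset.sum_congr rfl fun b _ => by ring
      rw [e2, hone, mul_one, mul_add]
      have e3 : (q h : ℝ) * ((1 - (q h : ℝ)) / (q h : ℝ) * TW (j + 1)) = (1 - (q h : ℝ)) * TW (j + 1) := by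
        field_simp
      rw [e3, add_comm]
    rw [e]
    exact mul_le_mul_of_nonneg_left hτ hqh.le
  calc μ.real {ω' : Set (Fin n) | ((L ∪ K.biUnion fun b => insert b (B b)).filter
        fun a => a = o ∨ ∀ i, i ≤ depth a → par^[i] a ∈ ω').card ≤ j}
      ≤ μ.real ER := hred
    _ = 1 - μ.real ERc := hcompl
    _ ≤ 1 - (q h : ℝ) * τ := by linarith

/-- **FAR at every layer for 'hub + leaves + ANY root blocks', conditional on the vertex inequalities.**  Setting of
`Quant.farTree_hubBlocks_of_profile`; `U = Σ_{ℓ∈L} q ℓ > 0`, an integer `n₀` with `n₀ ≤ U < n₀ + 1` and `n₀ < |L|`; block profile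
`ℓ b = P(W ≥ j+1−b) + ((1−q h)/q h)·P(W ≥ j+1)`.  If the vertex inequalities `(V_{t,b₁})` (Poisson weights `U^i/i!`) hold for `ℓ`, `τ` and all
`t ≤ n₀ < b₁ ≤ |L|`, and `1 − q h·τ ≤ t`, then `P(#{a ∈ A counted} ≤ j) ≤ t`.  (With `τ = min(U/|L|, g_min/q h)`, `1 − q h τ = 1 − θ̄ ≤ 1 − θ`.)
[this work] -/
theorem farTree_hubBlocks_of_vertices (q : Fin n → unitInterval) (o h : Fin n) (L K : Finset (Fin n)) (B : Fin n → Finset (Fin n))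
    (depth : Fin n → ℕ) (par : Fin n → Fin n) (j n₀ : ℕ) (τ t : ℝ)
    (hK : ∀ b ∈ K, par b = o ∧ depth b = 0)
    (hL : ∀ a ∈ L, par a = h ∧ depth a = 1) (hB : ∀ b ∈ K, ∀ a ∈ B b, par a = b ∧ depth a = 1)
    (hhL : h ∉ L) (hhK : h ∉ K) (hLK : Disjoint L K) (hLB : ∀ b ∈ K, Disjoint L (B b))
    (hKB : ∀ b ∈ K, ∀ b' ∈ K, b ∉ B b') (hBB : ∀ b ∈ K, ∀ b' ∈ K, b ≠ b' → Disjoint (B b) (B b'))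
    (hqB : ∀ b ∈ K, ∀ a ∈ B b, q a = 1) (hqh : 0 < (q h : ℝ))
    (hU0 : 0 < ∑ i ∈ L, (q i : ℝ)) (hnU : (n₀ : ℝ) ≤ ∑ i ∈ L, (q i : ℝ)) (hUn : ∑ i ∈ L, (q i : ℝ) < n₀ + 1)
    (hnL : n₀ < L.card)
    (hV : ∀ t' b₁, t' ≤ n₀ → n₀ < b₁ → b₁ ≤ L.card →
      0 ≤ (∑ i ∈ Finset.Ico t' (n₀ + 1),
            (((prodBernoulli q).real {ω : Set (Fin n) | j + 1 - i ≤ ∑ x ∈ K.filter (fun x => x ∈ ω), ((B x).card + 1)} +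
              (1 - (q h : ℝ)) / (q h : ℝ) *
                (prodBernoulli q).real {ω : Set (Fin n) | j + 1 ≤ ∑ x ∈ K.filter (fun x => x ∈ ω), ((B x).card + 1)}) - τ) *
              ((∑ i ∈ L, (q i : ℝ)) ^ i / (Nat.factorial i : ℝ))) * ((b₁ : ℝ) - ∑ i ∈ L, (q i : ℝ)) +
        (((prodBernoulli q).real {ω : Set (Fin n) | j + 1 - b₁ ≤ ∑ x ∈ K.filter (fun x => x ∈ ω), ((B x).card + 1)} +
              (1 - (q h : ℝ)) / (q h : ℝ) *
                (prodBernoulli q).real {ω : Set (Fin n) | j + 1 ≤ ∑ x ∈ K.filter (fun x => x ∈ ω), ((B x).card + 1)}) - τ) *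
          ∑ i ∈ Finset.Ico t' (n₀ + 1), ((∑ i ∈ L, (q i : ℝ)) - i) * ((∑ i ∈ L, (q i : ℝ)) ^ i / (Nat.factorial i : ℝ)))
    (ht : 1 - (q h : ℝ) * τ ≤ t) :
    (prodBernoulli q).real {ω' : Set (Fin n) |
      ((L ∪ K.biUnion fun b => insert b (B b)).filter
        fun a => a = o ∨ ∀ i, i ≤ depth a → par^[i] a ∈ ω').card ≤ j} ≤ t := by
  set ℓ : ℕ → ℝ := fun b =>
    (prodBernoulli q).real {ω : Set (Fin n) | j + 1 - b ≤ ∑ x ∈ K.filter (fun x => x ∈ ω), ((B x).card + 1)} +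
      (1 - (q h : ℝ)) / (q h : ℝ) *
        (prodBernoulli q).real {ω : Set (Fin n) | j + 1 ≤ ∑ x ∈ K.filter (fun x => x ∈ ω), ((B x).card + 1)} with hℓ
  have hτ : τ ≤ ∑ b ∈ Finset.range (L.card + 1),
      (prodBernoulli q).real {ω : Set (Fin n) | (L.filter fun x => x ∈ ω).card = b} * ℓ b :=
    pb_expectation_ge_of_vertices q L n₀ ℓ τ hU0 hnU hUn hnL hV
  exact (farTree_hubBlocks_of_profile q o h L K B depth par j τ hK hL hB hhL hhK hLK hLB hKB hBB hqB hqh hτ).trans ht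

end Quant

end Summit.CriticalPhenomena.PercolationContinuityZ3.Theorems
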